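import Summits.QuantumFields.YangMills.Theses.ScalingWindowSplit
import Summits.QuantumFields.YangMills.Theorems.GronwallGapContinuumFromLatticeGapOneFieldLocal
import Summits.QuantumFields.YangMills.Theorems.ScalingWindowSplitExistenceLegFromLatticeGapped
import HarnessLib

/-!
# Crux `HypercubicLimit` (stmt-QuantumFields-16154), line `peel-and-disseminate`, reshape 6: the glue from the REPAIRED lattice triple

Helper file for the crux item stmt-QuantumFields-16154 (`CoincidenceRotationBootstrap.HypercubicLimit` =
`MirrorModularBoosts.WeakCouplingHypercubicLimit`).  The registered skeleton `Cruxes/HypercubicLimit/Lines/peel_and_disseminate.lean`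
(reshape 6, c5 seat) has three stubs — the r1 redirect strategist's REPAIRED lattice triple W₁ᴸ (`GapAtCorrelationLengthLocal`: the
RP-spectral clause over the LOCAL slab class), U_RS (`SelfNormalisedMomentBoundsRS`: simple `G`), W₂ᴳ (`ScalingWindowSplit.SelfNormalisedSkewnessGapped`,
stmt-QuantumFields-18170) — and this file lands its composition in the tree: `hypercubicLimit_of_localTriple`, the crux BY NAME from the three
stub statements (ONE FIELD SUFFICES `hypercubicLimit_iff_oneFieldWeak` + the landed LOCAL seam
`ContinuumFromLatticeGap.oneField_of_latticeInequalities_local`, U_RS fed the consumer's simplicity hypothesis; body = the strategist's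
certified `SplitGlue_r1.lean :: HypercubicLimit_of_subs`), together with `hypercubicLimit_of_currentTriple`: the CURRENT items
stmt-18927 / 18014 / 18170 close the crux THROUGH the repaired statements (W₁ → W₁ᴸ and U_R → U_RS are weakenings), so the day either
triple lands the crux closes by a three-token file.  The two stub statements are written exactly as registered (registry-safe rendering of
the strategist's `children.json`: `let x := v; b ↦ (fun x => b) v`, instance binders for the Borel structure).  No definitions, no sorry.
Refs: GlimmJaffe1987 §6.1, §19.1; OsterwalderSeiler1978 §§2–3.
-/

set_option autoImplicit false

noncomputable section

open scoped SchwartzMap BigOperators Topology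
open MeasureTheory Filter Topology Set Function
open Literature.MathematicalPhysics.AQFT Literature.MathematicalPhysics.QuantumLattice
open Literature.MathematicalPhysics.QuantumFieldTheory

namespace Summit.QuantumFields.YangMills.Theorems.HypercubicLimit.LocalTriple

/-- **The crux from the repaired lattice triple** (`stub_gapLocal → stub_momentBoundsRS → stub_skewnessGapped →
CoincidenceRotationBootstrap.HypercubicLimit`, the registered composition of line `peel-and-disseminate`, reshape 6): per compact simple
`G` take W₁ᴸ's witness `(r, sch, u, p, M, Δ, C)` at the Borel structure and apply the landed local seam, feeding U_RS the simplicity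
hypothesis and W₂ᴳ the lattice gap. [cite: GlimmJaffe1987, §6.1 and §19.1] -/
theorem hypercubicLimit_of_localTriple
    (hW : ∀ (G : Type) [Group G] [TopologicalSpace G] [IsTopologicalGroup G] [CompactSpace G] [MeasurableSpace G] [BorelSpace G], IsCompactSimpleLieGroup G → ∃ (r : LatticeRep G) (sch : SpeciesScheme (YMSpecies G)) (u : SchwartzMap (EuclideanSpace ℝ (Fin 4)) ℝ) (p : ℕ) (M Δ C : ℝ), (fun (bare : SpeciesScheme (YMSpecies G)) => (fun (T : SchwartzMap (EuclideanSpace ℝ (Fin 4)) ℝ → ℕ → ℝ) => sch.HasWeakCouplingLimit ∧ (∃ N : ℕ, 1 ≤ N ∧ ∀ᶠ k in Filter.atTop, (sch.a k)⁻¹ ≤ (sch.a k * (sch.L k : ℝ)) ^ N) ∧ 0 < Δ ∧ HasLatticeMassGap r sch Δ ∧ (∀ᶠ k in Filter.atTop, ∀ (S₀ T₀ n R : ℕ), sch.L k ≤ S₀ → 2 * (T₀ + n + 1) ≤ S₀ → 2 * (R + 1) ≤ S₀ → ∀ (Y : LGConfig 4 G → ℝ) (B : ℝ), Measurable Y → (∀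 U, |Y U| ≤ B) → DependsOn Y {e : Literature.MathematicalPhysics.QuantumLattice.ZdEdge 4 | (1 ≤ e.1 0 ∧ e.1 0 + (if e.2 = 0 then 1 else 0) ≤ T₀) ∧ ∀ i : Fin 4, i ≠ 0 → |e.1 i| ≤ R} → |(∫ U, Y (torusLift (2 * S₀ + 1) (GaugeConfig.timeReflect U)) * Y (configShift (-Pi.single 0 (n : ℤ)) (torusLift (2 * S₀ + 1) U)) ∂(wilsonMeasure r.ρ (sch.β k) : Measure (GaugeConfig 4 (2 * S₀ + 1) G))) - (∫ U, Y (torusLift (2 * S₀ + 1) U) ∂(wilsonMeasure r.ρ (sch.β k) : Measure (GaugeConfig 4 (2 * S₀ + 1) G))) ^ 2| ≤ Real.exp (-(Δ * sch.a k * n)) * ((∫ U, Y (torusLift (2 * S₀ + 1) (GaugeConfig.timeReflect U)) * Y (torusLift (2 * S₀ + 1) U) ∂(wilsonMeasure r.ρ (sch.β k) : Measure (GaugeConfig 4 (2 * S₀ + 1) G))) - (∫ U, Y (torusLift (2 * S₀ + 1) U) ∂(wilsonMeasure r.ρ (sch.β k) : Measure (GaugeConfig 4 (2 * S₀ + 1)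 G))) ^ 2) + C * B ^ 2 * Real.exp (-(Δ * sch.a k * S₀))) ∧ tsupport u ⊆ {y : EuclideanSpace ℝ (Fin 4) | y 0 < 0} ∧ ∀ᶠ k in Filter.atTop, (sch.a k) ^ p ≤ T u k ∧ T u k ≤ M * T (timeShiftTest 4 (-1) u) k) (fun w k => latticeSchwinger r.ρ bare (fun s => s.F) k (1 + 1) (fun _ => r.curvature) ![w, thetaTest 4 w] - latticeSchwinger r.ρ bare (fun s => s.F) k 1 (fun _ => r.curvature) ![w] * latticeSchwinger r.ρ bare (fun s => s.F) k 1 (fun _ => r.curvature) ![thetaTest 4 w])) (SpeciesScheme.mk sch.a sch.a_pos sch.tendsto_a sch.β sch.L sch.tendsto_L (fun _ _ => 1) (fun _ _ => 0)))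
    (hU : ∀ (G : Type) [Group G] [TopologicalSpace G] [IsTopologicalGroup G] [CompactSpace G] [MeasurableSpace G] [BorelSpace G], IsCompactSimpleLieGroup G → ∀ (r : LatticeRep G) (sch : SpeciesScheme (YMSpecies G)) (u : SchwartzMap (EuclideanSpace ℝ (Fin 4)) ℝ) (p : ℕ) (M : ℝ), (fun (bare : SpeciesScheme (YMSpecies G)) => (fun (T : SchwartzMap (EuclideanSpace ℝ (Fin 4)) ℝ → ℕ → ℝ) => (fun (canon : SpeciesScheme (YMSpecies G)) => sch.HasWeakCouplingLimit → (∃ N : ℕ, 1 ≤ N ∧ ∀ᶠ k in Filter.atTop, (sch.a k)⁻¹ ≤ (sch.a k * (sch.L k : ℝ)) ^ N) → tsupport u ⊆ {y : EuclideanSpace ℝ (Fin 4) | y 0 < 0} → (∀ᶠ k in Filter.atTop, (sch.a k) ^ p ≤ T u k ∧ T u k ≤ M * T (timeShiftTest 4 (-1) u) k) → ∃ (s : ℕ) (C₀ C₁ : ℝ), ∀ (n : ℕ) (F : Fin n → {q : Fin 4 × Fin 4 // q.1 < q.2} → SchwartzMap (EuclideanSpace ℝ (Fin 4)) ℝ),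 (∀ i, ∑ q, schwartzNorm s (ofRealTest (F i q)) ≤ 1) → (∀ i j, i ≠ j → ∀ q q', Disjoint (tsupport (F i q)) (tsupport (F j q'))) → ∀ k : ℕ, |∫ U, ∏ i, ∑ q : {q : Fin 4 × Fin 4 // q.1 < q.2}, smearedLatticeField (plaquetteObs r.ρ 0 q.1.1 q.1.2) (Literature.Probability.LatticeModels.box 4 (canon.L k)) (canon.a k) (canon.c r.curvature k) (canon.m r.curvature k / 6) (F i q) (torusLift (canon.side k) U) ∂(wilsonMeasure r.ρ (canon.β k) : Measure (GaugeConfig 4 (canon.side k) G))| ≤ C₀ * C₁ ^ n * n.factorial) (SpeciesScheme.mk sch.a sch.a_pos sch.tendsto_a sch.β sch.L sch.tendsto_L (fun _ k => (Real.sqrt (T u k))⁻¹) (fun _ k => ∫ U, r.curvature.F (torusLift (sch.side k) U) ∂(wilsonMeasure r.ρ (sch.β k))))) (fun w k => latticeSchwinger r.ρ bare (fun s => s.F) k (1 + 1) (fun _ => r.curvature) ![w, thetaTest 4 w] - latticeSchwinger r.ρ bare (fun s => s.F) k 1 (fun _ => r.curvature) ![w] * latticeSchwinger r.ρ bare (fun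 s => s.F) k 1 (fun _ => r.curvature) ![thetaTest 4 w])) (SpeciesScheme.mk sch.a sch.a_pos sch.tendsto_a sch.β sch.L sch.tendsto_L (fun _ _ => 1) (fun _ _ => 0)))
    (hS : Summit.QuantumFields.YangMills.Theses.ScalingWindowSplit.SelfNormalisedSkewnessGapped) :
    Summit.QuantumFields.YangMills.Theses.CoincidenceRotationBootstrap.HypercubicLimit := by
  refine Summit.QuantumFields.YangMills.Theorems.HypercubicLimit.OneFieldWeak.hypercubicLimit_iff_oneFieldWeak.mpr
    fun G _ _ _ _ hG => ?_
  letI : MeasurableSpace G := borel G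
  haveI : BorelSpace G := ⟨rfl⟩
  obtain ⟨r, sch, u, p, M, Δ, C, hw, hpv, hΔ, hgap, hrp, hu, hfw⟩ := hW G hG
  obtain ⟨sch', S₁, hw', h₁⟩ :=
    Summit.QuantumFields.YangMills.Theorems.ContinuumFromLatticeGap.oneField_of_latticeInequalities_local
      r sch u p M Δ C hw hpv hΔ hgap hrp hu hfw
      (hU G hG r sch u p M hw hpv hu hfw) (hS G r sch u p M Δ hw hΔ hgap hpv hu hfw)
  exact ⟨r, sch', S₁, hw', h₁⟩

/-- **W₁ → W₁ᴸ** (the CURRENT stmt-18927 implies the first stub statement: the local slab class is a subclass of the slab class,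
and every Borel structure is `borel G`).
-- adapted from Cruxes/GapAtCorrelationLength/RestateKit.lean [folklore] -/
theorem gapLocal_of_gapAtCorrelationLength
    (h : Summit.QuantumFields.YangMills.Theses.ScalingWindowSplit.GapAtCorrelationLength) :
    ∀ (G : Type) [Group G] [TopologicalSpace G] [IsTopologicalGroup G] [CompactSpace G] [MeasurableSpace G] [BorelSpace G], IsCompactSimpleLieGroup G → ∃ (r : LatticeRep G) (sch : SpeciesScheme (YMSpecies G)) (u : SchwartzMap (EuclideanSpace ℝ (Fin 4)) ℝ) (p : ℕ) (M Δ C : ℝ), (fun (bare : SpeciesScheme (YMSpecies G)) => (fun (T : SchwartzMap (EuclideanSpace ℝ (Fin 4)) ℝ → ℕ → ℝ) => sch.HasWeakCouplingLimit ∧ (∃ N : ℕ, 1 ≤ N ∧ ∀ᶠ k in Filter.atTop, (sch.a k)⁻¹ ≤ (sch.a k * (sch.L k : ℝ)) ^ N) ∧ 0 < Δ ∧ HasLatticeMassGap r sch Δ ∧ (∀ᶠ k in Filter.atTop, ∀ (S₀ T₀ n R : ℕ), sch.L k ≤ S₀ → 2 * (T₀ + n + 1) ≤ S₀ → 2 *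 (R + 1) ≤ S₀ → ∀ (Y : LGConfig 4 G → ℝ) (B : ℝ), Measurable Y → (∀ U, |Y U| ≤ B) → DependsOn Y {e : Literature.MathematicalPhysics.QuantumLattice.ZdEdge 4 | (1 ≤ e.1 0 ∧ e.1 0 + (if e.2 = 0 then 1 else 0) ≤ T₀) ∧ ∀ i : Fin 4, i ≠ 0 → |e.1 i| ≤ R} → |(∫ U, Y (torusLift (2 * S₀ + 1) (GaugeConfig.timeReflect U)) * Y (configShift (-Pi.single 0 (n : ℤ)) (torusLift (2 * S₀ + 1) U)) ∂(wilsonMeasure r.ρ (sch.β k) : Measure (GaugeConfig 4 (2 * S₀ + 1) G))) - (∫ U, Y (torusLift (2 * S₀ + 1) U) ∂(wilsonMeasure r.ρ (sch.β k) : Measure (GaugeConfig 4 (2 * S₀ + 1) G))) ^ 2| ≤ Real.exp (-(Δ * sch.a k * n)) * ((∫ U, Y (torusLift (2 * S₀ + 1) (GaugeConfig.timeReflect U)) * Y (torusLift (2 * S₀ + 1) U) ∂(wilsonMeasure r.ρ (sch.β k) : Measure (GaugeConfig 4 (2 * S₀ + 1) G))) - (∫ U, Y (torusLift (2 * S₀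 + 1) U) ∂(wilsonMeasure r.ρ (sch.β k) : Measure (GaugeConfig 4 (2 * S₀ + 1) G))) ^ 2) + C * B ^ 2 * Real.exp (-(Δ * sch.a k * S₀))) ∧ tsupport u ⊆ {y : EuclideanSpace ℝ (Fin 4) | y 0 < 0} ∧ ∀ᶠ k in Filter.atTop, (sch.a k) ^ p ≤ T u k ∧ T u k ≤ M * T (timeShiftTest 4 (-1) u) k) (fun w k => latticeSchwinger r.ρ bare (fun s => s.F) k (1 + 1) (fun _ => r.curvature) ![w, thetaTest 4 w] - latticeSchwinger r.ρ bare (fun s => s.F) k 1 (fun _ => r.curvature) ![w] * latticeSchwinger r.ρ bare (fun s => s.F) k 1 (fun _ => r.curvature) ![thetaTest 4 w])) (SpeciesScheme.mk sch.a sch.a_pos sch.tendsto_a sch.β sch.L sch.tendsto_L (fun _ _ => 1) (fun _ _ => 0)) := by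
  intro G _ _ _ _ _ hB hG
  obtain ⟨hB'⟩ := hB
  subst hB'
  obtain ⟨r, sch, u, p, M, Δ, C, hw, hpv, hΔ, hgap, hrp, hu, hfw⟩ := h G hG
  refine ⟨r, sch, u, p, M, Δ, C, hw, hpv, hΔ, hgap, ?_, hu, hfw⟩
  filter_upwards [hrp] with k hk S₀ T₀ n R hL h2 _hR Y B hYm hYb hYdep
  exact hk S₀ T₀ n hL h2 Y B hYm hYb (hYdep.mono fun e he => he.1)

/-- **U_R → U_RS** (the CURRENT stmt-18014 implies the second stub statement: drop the simplicity hypothesis).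
-- adapted from Cruxes/SelfNormalisedMomentBoundsR/MaskedSectorObstruction.lean [folklore] -/
theorem momentBoundsRS_of_selfNormalisedMomentBoundsR
    (h : Summit.QuantumFields.YangMills.Theses.ScalingWindowSplit.SelfNormalisedMomentBoundsR) :
    ∀ (G : Type) [Group G] [TopologicalSpace G] [IsTopologicalGroup G] [CompactSpace G] [MeasurableSpace G] [BorelSpace G], IsCompactSimpleLieGroup G → ∀ (r : LatticeRep G) (sch : SpeciesScheme (YMSpecies G)) (u : SchwartzMap (EuclideanSpace ℝ (Fin 4)) ℝ) (p : ℕ) (M : ℝ), (fun (bare : SpeciesScheme (YMSpecies G)) => (fun (T : SchwartzMap (EuclideanSpace ℝ (Fin 4)) ℝ → ℕ → ℝ) => (fun (canon : SpeciesScheme (YMSpecies G)) => sch.HasWeakCouplingLimit → (∃ N : ℕ, 1 ≤ N ∧ ∀ᶠ k in Filter.atTop, (sch.a k)⁻¹ ≤ (sch.a k * (sch.L k : ℝ)) ^ N) → tsupport u ⊆ {y : EuclideanSpace ℝ (Fin 4) | y 0 < 0} → (∀ᶠ k in Filter.atTop, (sch.a k) ^ p ≤ T u k ∧ T u k ≤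 M * T (timeShiftTest 4 (-1) u) k) → ∃ (s : ℕ) (C₀ C₁ : ℝ), ∀ (n : ℕ) (F : Fin n → {q : Fin 4 × Fin 4 // q.1 < q.2} → SchwartzMap (EuclideanSpace ℝ (Fin 4)) ℝ), (∀ i, ∑ q, schwartzNorm s (ofRealTest (F i q)) ≤ 1) → (∀ i j, i ≠ j → ∀ q q', Disjoint (tsupport (F i q)) (tsupport (F j q'))) → ∀ k : ℕ, |∫ U, ∏ i, ∑ q : {q : Fin 4 × Fin 4 // q.1 < q.2}, smearedLatticeField (plaquetteObs r.ρ 0 q.1.1 q.1.2) (Literature.Probability.LatticeModels.box 4 (canon.L k)) (canon.a k) (canon.c r.curvature k) (canon.m r.curvature k / 6) (F i q) (torusLift (canon.side k) U) ∂(wilsonMeasure r.ρ (canon.β k) : Measure (GaugeConfig 4 (canon.side k) G))| ≤ C₀ * C₁ ^ n * n.factorial) (SpeciesScheme.mk sch.a sch.a_pos sch.tendsto_a sch.β sch.L sch.tendsto_L (fun _ k => (Real.sqrt (T u k))⁻¹) (fun _ k => ∫ U, r.curvature.F (torusLift (sch.side k) U) ∂(wilsonMeasure r.ρ (sch.β k)))))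 (fun w k => latticeSchwinger r.ρ bare (fun s => s.F) k (1 + 1) (fun _ => r.curvature) ![w, thetaTest 4 w] - latticeSchwinger r.ρ bare (fun s => s.F) k 1 (fun _ => r.curvature) ![w] * latticeSchwinger r.ρ bare (fun s => s.F) k 1 (fun _ => r.curvature) ![thetaTest 4 w])) (SpeciesScheme.mk sch.a sch.a_pos sch.tendsto_a sch.β sch.L sch.tendsto_L (fun _ _ => 1) (fun _ _ => 0)) := by
  intro G _ _ _ _ _ _ _hG r sch u p M
  exact h G r sch u p M

/-- **The CURRENT ScalingWindowSplit triple closes the crux through the repaired statements** (so does the route's own typed split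
`existenceLegFromLatticeGapped_proof`; this is the square's other path). [cite: GlimmJaffe1987, §6.1 and §19.1] -/
theorem hypercubicLimit_of_currentTriple
    (hW : Summit.QuantumFields.YangMills.Theses.ScalingWindowSplit.GapAtCorrelationLength)
    (hU : Summit.QuantumFields.YangMills.Theses.ScalingWindowSplit.SelfNormalisedMomentBoundsR)
    (hS : Summit.QuantumFields.YangMills.Theses.ScalingWindowSplit.SelfNormalisedSkewnessGapped) :
    Summit.QuantumFields.YangMills.Theses.CoincidenceRotationBootstrap.HypercubicLimit :=
  hypercubicLimit_of_localTriple (gapLocal_of_gapAtCorrelationLength hW) (momentBoundsRS_of_selfNormalisedMomentBoundsR hU) hS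


/-! ## Appended (c5 seat, same day): the bridge from the FILED texts, so that the split's glue item closes by a three-token file -/

/-- **Filed W₁ᴸ ⇒ registered W₁ᴸ.**  The text filed in the prepared `--split` (`Cruxes/HypercubicLimit/SPLIT-r1.md` children.json[0] =
`Cruxes/GapAtCorrelationLength/RestateKit.lean :: GapAtCorrelationLengthLocal`, here with its `let E` expanded) installs the Borel
structure `borel G`; the registered rendering quantifies over every Borel structure — which IS `borel G`. [folklore] -/
theorem gapLocal_of_filed
    (h : ∀ (G : Type) [Group G] [TopologicalSpace G] [IsTopologicalGroup G] [CompactSpace G], IsCompactSimpleLieGroup G → letI : MeasurableSpace G := borel G; haveI : BorelSpace G := ⟨rfl⟩; ∃ (r : LatticeRep G) (sch : SpeciesScheme (YMSpecies G)) (u : SchwartzMap (EuclideanSpace ℝ (Fin 4)) ℝ) (p : ℕ) (M Δ C : ℝ), let bare : SpeciesScheme (YMSpecies G) := { sch with c := fun _ _ => 1, m := fun _ _ => 0 }; let T : SchwartzMap (EuclideanSpace ℝ (Fin 4)) ℝ → ℕ → ℝ := fun w k => latticeSchwinger r.ρ bare (fun s => s.F) k (1 + 1) (fun _ => r.curvature)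 ![w, thetaTest 4 w] - latticeSchwinger r.ρ bare (fun s => s.F) k 1 (fun _ => r.curvature) ![w] * latticeSchwinger r.ρ bare (fun s => s.F) k 1 (fun _ => r.curvature) ![thetaTest 4 w]; sch.HasWeakCouplingLimit ∧ (∃ N : ℕ, 1 ≤ N ∧ ∀ᶠ k in Filter.atTop, (sch.a k)⁻¹ ≤ (sch.a k * (sch.L k : ℝ)) ^ N) ∧ 0 < Δ ∧ HasLatticeMassGap r sch Δ ∧ (∀ᶠ k in Filter.atTop, ∀ (S₀ T₀ n R : ℕ), sch.L k ≤ S₀ → 2 * (T₀ + n + 1) ≤ S₀ → 2 * (R + 1) ≤ S₀ → ∀ (Y : LGConfig 4 G → ℝ) (B : ℝ), Measurable Y → (∀ U, |Y U| ≤ B) → DependsOn Y {e : Literature.MathematicalPhysics.QuantumLattice.ZdEdge 4 | (1 ≤ e.1 0 ∧ e.1 0 + (if e.2 = 0 then 1 else 0) ≤ T₀) ∧ ∀ i : Fin 4, i ≠ 0 → |e.1 i| ≤ R} → |(∫ U, Y (torusLift (2 * S₀ + 1) (GaugeConfig.timeReflect U)) * Y (configShift (-Pi.single 0 (n : ℤ))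 (torusLift (2 * S₀ + 1) U)) ∂(wilsonMeasure r.ρ (sch.β k) : Measure (GaugeConfig 4 (2 * S₀ + 1) G))) - (∫ U, Y (torusLift (2 * S₀ + 1) U) ∂(wilsonMeasure r.ρ (sch.β k) : Measure (GaugeConfig 4 (2 * S₀ + 1) G))) ^ 2| ≤ Real.exp (-(Δ * sch.a k * n)) * ((∫ U, Y (torusLift (2 * S₀ + 1) (GaugeConfig.timeReflect U)) * Y (torusLift (2 * S₀ + 1) U) ∂(wilsonMeasure r.ρ (sch.β k) : Measure (GaugeConfig 4 (2 * S₀ + 1) G))) - (∫ U, Y (torusLift (2 * S₀ + 1) U) ∂(wilsonMeasure r.ρ (sch.β k) : Measure (GaugeConfig 4 (2 * S₀ + 1) G))) ^ 2) + C * B ^ 2 * Real.exp (-(Δ * sch.a k * S₀))) ∧ tsupport u ⊆ {y : EuclideanSpace ℝ (Fin 4) | y 0 < 0} ∧ ∀ᶠ k in Filter.atTop, (sch.a k) ^ p ≤ T u k ∧ T u k ≤ M * T (timeShiftTest 4 (-1) u) k) :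
    ∀ (G : Type) [Group G] [TopologicalSpace G] [IsTopologicalGroup G] [CompactSpace G] [MeasurableSpace G] [BorelSpace G], IsCompactSimpleLieGroup G → ∃ (r : LatticeRep G) (sch : SpeciesScheme (YMSpecies G)) (u : SchwartzMap (EuclideanSpace ℝ (Fin 4)) ℝ) (p : ℕ) (M Δ C : ℝ), (fun (bare : SpeciesScheme (YMSpecies G)) => (fun (T : SchwartzMap (EuclideanSpace ℝ (Fin 4)) ℝ → ℕ → ℝ) => sch.HasWeakCouplingLimit ∧ (∃ N : ℕ, 1 ≤ N ∧ ∀ᶠ k in Filter.atTop, (sch.a k)⁻¹ ≤ (sch.a k * (sch.L k : ℝ)) ^ N) ∧ 0 < Δ ∧ HasLatticeMassGap r sch Δ ∧ (∀ᶠ k in Filter.atTop, ∀ (S₀ T₀ n R : ℕ), sch.L k ≤ S₀ → 2 * (T₀ + n + 1) ≤ S₀ → 2 * (R + 1) ≤ S₀ → ∀ (Y : LGConfig 4 G → ℝ) (B : ℝ), Measurable Y → (∀ U, |Y U| ≤ B) → DependsOn Y {e : Literature.MathematicalPhysics.QuantumLattice.ZdEdge 4 | (1 ≤ e.1 0 ∧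 e.1 0 + (if e.2 = 0 then 1 else 0) ≤ T₀) ∧ ∀ i : Fin 4, i ≠ 0 → |e.1 i| ≤ R} → |(∫ U, Y (torusLift (2 * S₀ + 1) (GaugeConfig.timeReflect U)) * Y (configShift (-Pi.single 0 (n : ℤ)) (torusLift (2 * S₀ + 1) U)) ∂(wilsonMeasure r.ρ (sch.β k) : Measure (GaugeConfig 4 (2 * S₀ + 1) G))) - (∫ U, Y (torusLift (2 * S₀ + 1) U) ∂(wilsonMeasure r.ρ (sch.β k) : Measure (GaugeConfig 4 (2 * S₀ + 1) G))) ^ 2| ≤ Real.exp (-(Δ * sch.a k * n)) * ((∫ U, Y (torusLift (2 * S₀ + 1) (GaugeConfig.timeReflect U)) * Y (torusLift (2 * S₀ + 1) U) ∂(wilsonMeasure r.ρ (sch.β k) : Measure (GaugeConfig 4 (2 * S₀ + 1) G))) - (∫ U, Y (torusLift (2 * S₀ + 1) U) ∂(wilsonMeasure r.ρ (sch.β k) : Measure (GaugeConfig 4 (2 * S₀ + 1) G))) ^ 2) + C * B ^ 2 * Real.exp (-(Δ * sch.a k * S₀))) ∧ tsupport u ⊆ {y : EuclideanSpace ℝ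 (Fin 4) | y 0 < 0} ∧ ∀ᶠ k in Filter.atTop, (sch.a k) ^ p ≤ T u k ∧ T u k ≤ M * T (timeShiftTest 4 (-1) u) k) (fun w k => latticeSchwinger r.ρ bare (fun s => s.F) k (1 + 1) (fun _ => r.curvature) ![w, thetaTest 4 w] - latticeSchwinger r.ρ bare (fun s => s.F) k 1 (fun _ => r.curvature) ![w] * latticeSchwinger r.ρ bare (fun s => s.F) k 1 (fun _ => r.curvature) ![thetaTest 4 w])) (SpeciesScheme.mk sch.a sch.a_pos sch.tendsto_a sch.β sch.L sch.tendsto_L (fun _ _ => 1) (fun _ _ => 0)) := by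
  intro G _ _ _ _ _ hB hG
  obtain ⟨hB'⟩ := hB
  subst hB'
  exact h G hG

/-- **Filed U_RS ⇒ registered U_RS** (the two texts agree up to β/ζ-reduction: `let x := v; b` versus `(fun x => b) v`). [folklore] -/
theorem momentBoundsRS_of_filed
    (h : ∀ (G : Type) [Group G] [TopologicalSpace G] [IsTopologicalGroup G] [CompactSpace G] [MeasurableSpace G] [BorelSpace G], IsCompactSimpleLieGroup G → ∀ (r : LatticeRep G) (sch : SpeciesScheme (YMSpecies G)) (u : SchwartzMap (EuclideanSpace ℝ (Fin 4)) ℝ) (p : ℕ) (M : ℝ), let bare : SpeciesScheme (YMSpecies G) := { sch with c := fun _ _ => 1, m := fun _ _ => 0 }; let T : SchwartzMap (EuclideanSpace ℝ (Fin 4)) ℝ → ℕ → ℝ := fun w k => latticeSchwinger r.ρ bare (fun s => s.F) k (1 + 1) (fun _ => r.curvature) ![w, thetaTest 4 w] - latticeSchwinger r.ρ bare (fun s => s.F) k 1 (fun _ => r.curvature) ![w] * latticeSchwinger r.ρ bare (fun s => s.F) k 1 (fun _ => r.curvature) ![thetaTest 4 w]; let canon : SpeciesScheme (YMSpecies G)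 := { sch with c := fun _ k => (Real.sqrt (T u k))⁻¹, m := fun _ k => ∫ U, r.curvature.F (torusLift (sch.side k) U) ∂(wilsonMeasure r.ρ (sch.β k)) }; sch.HasWeakCouplingLimit → (∃ N : ℕ, 1 ≤ N ∧ ∀ᶠ k in Filter.atTop, (sch.a k)⁻¹ ≤ (sch.a k * (sch.L k : ℝ)) ^ N) → tsupport u ⊆ {y : EuclideanSpace ℝ (Fin 4) | y 0 < 0} → (∀ᶠ k in Filter.atTop, (sch.a k) ^ p ≤ T u k ∧ T u k ≤ M * T (timeShiftTest 4 (-1) u) k) → ∃ (s : ℕ) (C₀ C₁ : ℝ), ∀ (n : ℕ) (F : Fin n → {q : Fin 4 × Fin 4 // q.1 < q.2} → SchwartzMap (EuclideanSpace ℝ (Fin 4)) ℝ), (∀ i, ∑ q, schwartzNorm s (ofRealTest (F i q)) ≤ 1) → (∀ i j, i ≠ j → ∀ q q', Disjoint (tsupport (F i q)) (tsupport (F j q'))) → ∀ k : ℕ, |∫ U, ∏ i, ∑ q : {q : Fin 4 × Fin 4 // q.1 < q.2}, smearedLatticeField (plaquetteObs r.ρ 0 q.1.1 q.1.2) (Literature.Probability.LatticeModels.box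 4 (canon.L k)) (canon.a k) (canon.c r.curvature k) (canon.m r.curvature k / 6) (F i q) (torusLift (canon.side k) U) ∂(wilsonMeasure r.ρ (canon.β k) : Measure (GaugeConfig 4 (canon.side k) G))| ≤ C₀ * C₁ ^ n * n.factorial) :
    ∀ (G : Type) [Group G] [TopologicalSpace G] [IsTopologicalGroup G] [CompactSpace G] [MeasurableSpace G] [BorelSpace G], IsCompactSimpleLieGroup G → ∀ (r : LatticeRep G) (sch : SpeciesScheme (YMSpecies G)) (u : SchwartzMap (EuclideanSpace ℝ (Fin 4)) ℝ) (p : ℕ) (M : ℝ), (fun (bare : SpeciesScheme (YMSpecies G)) => (fun (T : SchwartzMap (EuclideanSpace ℝ (Fin 4)) ℝ → ℕ → ℝ) => (fun (canon : SpeciesScheme (YMSpecies G)) => sch.HasWeakCouplingLimit → (∃ N : ℕ, 1 ≤ N ∧ ∀ᶠ k in Filter.atTop, (sch.a k)⁻¹ ≤ (sch.a k * (sch.L k : ℝ)) ^ N) → tsupport u ⊆ {y : EuclideanSpace ℝ (Fin 4) | y 0 < 0} → (∀ᶠ k in Filter.atTop, (sch.a k) ^ p ≤ T u k ∧ T u k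 ≤ M * T (timeShiftTest 4 (-1) u) k) → ∃ (s : ℕ) (C₀ C₁ : ℝ), ∀ (n : ℕ) (F : Fin n → {q : Fin 4 × Fin 4 // q.1 < q.2} → SchwartzMap (EuclideanSpace ℝ (Fin 4)) ℝ), (∀ i, ∑ q, schwartzNorm s (ofRealTest (F i q)) ≤ 1) → (∀ i j, i ≠ j → ∀ q q', Disjoint (tsupport (F i q)) (tsupport (F j q'))) → ∀ k : ℕ, |∫ U, ∏ i, ∑ q : {q : Fin 4 × Fin 4 // q.1 < q.2}, smearedLatticeField (plaquetteObs r.ρ 0 q.1.1 q.1.2) (Literature.Probability.LatticeModels.box 4 (canon.L k)) (canon.a k) (canon.c r.curvature k) (canon.m r.curvature k / 6) (F i q) (torusLift (canon.side k) U) ∂(wilsonMeasure r.ρ (canon.β k) : Measure (GaugeConfig 4 (canon.side k) G))| ≤ C₀ * C₁ ^ n * n.factorial) (SpeciesScheme.mk sch.a sch.a_pos sch.tendsto_a sch.β sch.L sch.tendsto_L (fun _ k => (Real.sqrt (T u k))⁻¹) (fun _ k => ∫ U, r.curvature.F (torusLift (sch.side k) U) ∂(wilsonMeasure r.ρ (sch.β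 k))))) (fun w k => latticeSchwinger r.ρ bare (fun s => s.F) k (1 + 1) (fun _ => r.curvature) ![w, thetaTest 4 w] - latticeSchwinger r.ρ bare (fun s => s.F) k 1 (fun _ => r.curvature) ![w] * latticeSchwinger r.ρ bare (fun s => s.F) k 1 (fun _ => r.curvature) ![thetaTest 4 w])) (SpeciesScheme.mk sch.a sch.a_pos sch.tendsto_a sch.β sch.L sch.tendsto_L (fun _ _ => 1) (fun _ _ => 0)) :=
  h

/-- **The crux from the FILED repaired triple** (children order of the prepared split W₁ᴸ, U_RS, W₂ᴳ): the closing file of the split's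
generated glue item is this theorem applied to the three child decls (each `Iff.rfl` to the texts here). [cite: GlimmJaffe1987, §6.1 and §19.1] -/
theorem hypercubicLimit_of_filedTriple
    (hW : ∀ (G : Type) [Group G] [TopologicalSpace G] [IsTopologicalGroup G] [CompactSpace G], IsCompactSimpleLieGroup G → letI : MeasurableSpace G := borel G; haveI : BorelSpace G := ⟨rfl⟩; ∃ (r : LatticeRep G) (sch : SpeciesScheme (YMSpecies G)) (u : SchwartzMap (EuclideanSpace ℝ (Fin 4)) ℝ) (p : ℕ) (M Δ C : ℝ), let bare : SpeciesScheme (YMSpecies G) := { sch with c := fun _ _ => 1, m := fun _ _ => 0 }; let T : SchwartzMap (EuclideanSpace ℝ (Fin 4)) ℝ → ℕ → ℝ := fun w k => latticeSchwinger r.ρ bare (fun s => s.F) k (1 + 1) (fun _ => r.curvature) ![w, thetaTest 4 w] - latticeSchwinger r.ρ bare (fun s => s.F) k 1 (fun _ => r.curvature) ![w] * latticeSchwinger r.ρ bare (fun s => s.F) k 1 (fun _ => r.curvature) ![thetaTest 4 w]; sch.HasWeakCouplingLimit ∧ (∃ N : ℕ, 1 ≤ N ∧ ∀ᶠ k in Filter.atTop,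 (sch.a k)⁻¹ ≤ (sch.a k * (sch.L k : ℝ)) ^ N) ∧ 0 < Δ ∧ HasLatticeMassGap r sch Δ ∧ (∀ᶠ k in Filter.atTop, ∀ (S₀ T₀ n R : ℕ), sch.L k ≤ S₀ → 2 * (T₀ + n + 1) ≤ S₀ → 2 * (R + 1) ≤ S₀ → ∀ (Y : LGConfig 4 G → ℝ) (B : ℝ), Measurable Y → (∀ U, |Y U| ≤ B) → DependsOn Y {e : Literature.MathematicalPhysics.QuantumLattice.ZdEdge 4 | (1 ≤ e.1 0 ∧ e.1 0 + (if e.2 = 0 then 1 else 0) ≤ T₀) ∧ ∀ i : Fin 4, i ≠ 0 → |e.1 i| ≤ R} → |(∫ U, Y (torusLift (2 * S₀ + 1) (GaugeConfig.timeReflect U)) * Y (configShift (-Pi.single 0 (n : ℤ)) (torusLift (2 * S₀ + 1) U)) ∂(wilsonMeasure r.ρ (sch.β k) : Measure (GaugeConfig 4 (2 * S₀ + 1) G))) - (∫ U, Y (torusLift (2 * S₀ + 1) U) ∂(wilsonMeasure r.ρ (sch.β k) : Measure (GaugeConfig 4 (2 * S₀ + 1) G))) ^ 2| ≤ Real.exp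 (-(Δ * sch.a k * n)) * ((∫ U, Y (torusLift (2 * S₀ + 1) (GaugeConfig.timeReflect U)) * Y (torusLift (2 * S₀ + 1) U) ∂(wilsonMeasure r.ρ (sch.β k) : Measure (GaugeConfig 4 (2 * S₀ + 1) G))) - (∫ U, Y (torusLift (2 * S₀ + 1) U) ∂(wilsonMeasure r.ρ (sch.β k) : Measure (GaugeConfig 4 (2 * S₀ + 1) G))) ^ 2) + C * B ^ 2 * Real.exp (-(Δ * sch.a k * S₀))) ∧ tsupport u ⊆ {y : EuclideanSpace ℝ (Fin 4) | y 0 < 0} ∧ ∀ᶠ k in Filter.atTop, (sch.a k) ^ p ≤ T u k ∧ T u k ≤ M * T (timeShiftTest 4 (-1) u) k)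
    (hU : ∀ (G : Type) [Group G] [TopologicalSpace G] [IsTopologicalGroup G] [CompactSpace G] [MeasurableSpace G] [BorelSpace G], IsCompactSimpleLieGroup G → ∀ (r : LatticeRep G) (sch : SpeciesScheme (YMSpecies G)) (u : SchwartzMap (EuclideanSpace ℝ (Fin 4)) ℝ) (p : ℕ) (M : ℝ), let bare : SpeciesScheme (YMSpecies G) := { sch with c := fun _ _ => 1, m := fun _ _ => 0 }; let T : SchwartzMap (EuclideanSpace ℝ (Fin 4)) ℝ → ℕ → ℝ := fun w k => latticeSchwinger r.ρ bare (fun s => s.F) k (1 + 1) (fun _ => r.curvature) ![w, thetaTest 4 w] - latticeSchwinger r.ρ bare (fun s => s.F) k 1 (fun _ => r.curvature) ![w] * latticeSchwinger r.ρ bare (fun s => s.F) k 1 (fun _ => r.curvature) ![thetaTest 4 w]; let canon : SpeciesScheme (YMSpecies G) := { sch with c := fun _ k => (Real.sqrt (T u k))⁻¹, m := fun _ k => ∫ U, r.curvature.F (torusLift (sch.side k) U) ∂(wilsonMeasure r.ρ (sch.β k)) }; sch.HasWeakCouplingLimit → (∃ N : ℕ, 1 ≤ N ∧ ∀ᶠ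 k in Filter.atTop, (sch.a k)⁻¹ ≤ (sch.a k * (sch.L k : ℝ)) ^ N) → tsupport u ⊆ {y : EuclideanSpace ℝ (Fin 4) | y 0 < 0} → (∀ᶠ k in Filter.atTop, (sch.a k) ^ p ≤ T u k ∧ T u k ≤ M * T (timeShiftTest 4 (-1) u) k) → ∃ (s : ℕ) (C₀ C₁ : ℝ), ∀ (n : ℕ) (F : Fin n → {q : Fin 4 × Fin 4 // q.1 < q.2} → SchwartzMap (EuclideanSpace ℝ (Fin 4)) ℝ), (∀ i, ∑ q, schwartzNorm s (ofRealTest (F i q)) ≤ 1) → (∀ i j, i ≠ j → ∀ q q', Disjoint (tsupport (F i q)) (tsupport (F j q'))) → ∀ k : ℕ, |∫ U, ∏ i, ∑ q : {q : Fin 4 × Fin 4 // q.1 < q.2}, smearedLatticeField (plaquetteObs r.ρ 0 q.1.1 q.1.2) (Literature.Probability.LatticeModels.box 4 (canon.L k)) (canon.a k) (canon.c r.curvature k) (canon.m r.curvature k / 6) (F i q) (torusLift (canon.side k) U) ∂(wilsonMeasure r.ρ (canon.β k) : Measure (GaugeConfig 4 (canon.side k) G))| ≤ C₀ * C₁ ^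 n * n.factorial)
    (hS : Summit.QuantumFields.YangMills.Theses.ScalingWindowSplit.SelfNormalisedSkewnessGapped) :
    Summit.QuantumFields.YangMills.Theses.CoincidenceRotationBootstrap.HypercubicLimit :=
  hypercubicLimit_of_localTriple (gapLocal_of_filed hW) (momentBoundsRS_of_filed hU) hS

end Summit.QuantumFields.YangMills.Theorems.HypercubicLimit.LocalTriple

end
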